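import Mathlib
import Summits.AtomisticToContinuum.HydrodynamicLimit.Theorems.JaynesSqueezeEntropicWeakStrongHSQuadA
import Summits.AtomisticToContinuum.HydrodynamicLimit.Theorems.JaynesSqueezeEntropicWeakStrongHSCoercive
import HarnessLib

/-!
# `EntropicWeakStrongHS` (stmt-AtomisticToContinuum-13461), pointwise IV: the grouped form of
# the relative flux, absorption, and the Taylor remainder of the compressibility factor

* `relFlux_scaled_eq` — `θ²ρ (∂ₜλ·(V - U) + Σᵢ ∂ᵢλ·(fᵢ(V) - fᵢ(U)))` equals the grouped quadratic
  form of `psi_identity` (time piece + three space pieces);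
* `absorb_quadratic'` — absorption of a grouped quadratic form given a bound on the *sum* of
  the absolute values of its coefficients;
* `exists_packing_interval`, `remainder_bound` — all densities met (classical solution on the
  slab, comparison states in `K`) lie in a compact interval of packing `< η₀`, on which the
  Taylor remainder of `y ↦ Z(yσ³)` is `O((r - ρ)²)` uniformly.
-/

noncomputable section

open Set Filter MeasureTheory Function
open scoped Topology ContDiff

namespace Summit.AtomisticToContinuum.HydrodynamicLimit.Theorems.EntropicWeakStrong

open Literature.MathematicalPhysics.KineticTheory Literature.Analysis.FunctionSpaces

/-! ### Absorption (sum form) -/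

/-- `|x y q| ≤ |q| (a² + b0² + b1² + b2² + c²)` when `x, y` are among `a, b0, b1, b2, c`
(here: `x² + y² ≤ 2 S`). -/
theorem abs_mul_mul_le_abs_mul {x y q S : ℝ} (hxy : x ^ 2 + y ^ 2 ≤ 2 * S) :
    |x * y * q| ≤ |q| * S := by
  rw [abs_mul, abs_mul]
  have h : |x| * |y| ≤ S := by nlinarith [sq_nonneg (|x| - |y|), sq_abs x, sq_abs y]
  calc |x| * |y| * |q| = |q| * (|x| * |y|) := by ring
    _ ≤ |q| * S := mul_le_mul_of_nonneg_left h (abs_nonneg _)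

/-- **Absorption, sum form.** With `Σₖ |qₖ| ≤ B` and `|R| ≤ C_R a²`, the grouped quadratic form
is at most `B (1 + C_R) (a² + b0² + b1² + b2² + c²)`. -/
theorem absorb_quadratic' {a b0 b1 b2 c R B CR q1 q2 q3 q4 q5 q6 q7 q8 q9 q10 q11 q12 q13 q14 q15 : ℝ}
    (hCR : 0 ≤ CR)
    (hq : |q1| + |q2| + |q3| + |q4| + |q5| + |q6| + |q7| + |q8| + |q9| + |q10| + |q11| + |q12| +
      |q13| + |q14| + |q15| ≤ B)
    (hR : |R| ≤ CR * a ^ 2) :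
    |a * a * q1 + a * b0 * q2 + a * b1 * q3 + a * b2 * q4 + a * c * q5 + b0 * b0 * q6 +
        b0 * b1 * q7 + b0 * b2 * q8 + b0 * c * q9 + b1 * b1 * q10 + b1 * b2 * q11 + b1 * c * q12 +
        b2 * b2 * q13 + b2 * c * q14 + R * q15| ≤
      B * (1 + CR) * (a ^ 2 + b0 ^ 2 + b1 ^ 2 + b2 ^ 2 + c ^ 2) := by
  set S := a ^ 2 + b0 ^ 2 + b1 ^ 2 + b2 ^ 2 + c ^ 2 with hS
  have hS0 : 0 ≤ S := by positivity
  have hB : 0 ≤ B := le_trans (by positivity) hq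
  have e1 := abs_mul_mul_le_abs_mul (x := a) (y := a) (q := q1) (S := S) (by rw [hS]; linarith [sq_nonneg b0, sq_nonneg b1, sq_nonneg b2, sq_nonneg c])
  have e2 := abs_mul_mul_le_abs_mul (x := a) (y := b0) (q := q2) (S := S) (by rw [hS]; linarith [sq_nonneg b1, sq_nonneg b2, sq_nonneg c, sq_nonneg a, sq_nonneg b0])
  have e3 := abs_mul_mul_le_abs_mul (x := a) (y := b1) (q := q3) (S := S) (by rw [hS]; linarith [sq_nonneg b0, sq_nonneg b2, sq_nonneg c, sq_nonneg a, sq_nonneg b1])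
  have e4 := abs_mul_mul_le_abs_mul (x := a) (y := b2) (q := q4) (S := S) (by rw [hS]; linarith [sq_nonneg b0, sq_nonneg b1, sq_nonneg c, sq_nonneg a, sq_nonneg b2])
  have e5 := abs_mul_mul_le_abs_mul (x := a) (y := c) (q := q5) (S := S) (by rw [hS]; linarith [sq_nonneg b0, sq_nonneg b1, sq_nonneg b2, sq_nonneg a, sq_nonneg c])
  have e6 := abs_mul_mul_le_abs_mul (x := b0) (y := b0) (q := q6) (S := S) (by rw [hS]; linarith [sq_nonneg a, sq_nonneg b1, sq_nonneg b2, sq_nonneg c])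
  have e7 := abs_mul_mul_le_abs_mul (x := b0) (y := b1) (q := q7) (S := S) (by rw [hS]; linarith [sq_nonneg a, sq_nonneg b2, sq_nonneg c, sq_nonneg b0, sq_nonneg b1])
  have e8 := abs_mul_mul_le_abs_mul (x := b0) (y := b2) (q := q8) (S := S) (by rw [hS]; linarith [sq_nonneg a, sq_nonneg b1, sq_nonneg c, sq_nonneg b0, sq_nonneg b2])
  have e9 := abs_mul_mul_le_abs_mul (x := b0) (y := c) (q := q9) (S := S) (by rw [hS]; linarith [sq_nonneg a, sq_nonneg b1, sq_nonneg b2, sq_nonneg b0, sq_nonneg c])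
  have e10 := abs_mul_mul_le_abs_mul (x := b1) (y := b1) (q := q10) (S := S) (by rw [hS]; linarith [sq_nonneg a, sq_nonneg b0, sq_nonneg b2, sq_nonneg c])
  have e11 := abs_mul_mul_le_abs_mul (x := b1) (y := b2) (q := q11) (S := S) (by rw [hS]; linarith [sq_nonneg a, sq_nonneg b0, sq_nonneg c, sq_nonneg b1, sq_nonneg b2])
  have e12 := abs_mul_mul_le_abs_mul (x := b1) (y := c) (q := q12) (S := S) (by rw [hS]; linarith [sq_nonneg a, sq_nonneg b0, sq_nonneg b2, sq_nonneg b1, sq_nonneg c])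
  have e13 := abs_mul_mul_le_abs_mul (x := b2) (y := b2) (q := q13) (S := S) (by rw [hS]; linarith [sq_nonneg a, sq_nonneg b0, sq_nonneg b1, sq_nonneg c])
  have e14 := abs_mul_mul_le_abs_mul (x := b2) (y := c) (q := q14) (S := S) (by rw [hS]; linarith [sq_nonneg a, sq_nonneg b0, sq_nonneg b1, sq_nonneg b2, sq_nonneg c])
  have e15 : |R * q15| ≤ |q15| * (CR * S) := by
    rw [abs_mul]
    have ha2 : a ^ 2 ≤ S := by rw [hS]; nlinarith [sq_nonneg b0, sq_nonneg b1, sq_nonneg b2, sq_nonneg c]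
    calc |R| * |q15| = |q15| * |R| := mul_comm _ _
      _ ≤ |q15| * (CR * S) := mul_le_mul_of_nonneg_left (hR.trans (mul_le_mul_of_nonneg_left ha2 hCR)) (abs_nonneg _)
  have hsum := mul_le_mul_of_nonneg_right hq hS0
  have h15 : |q15| ≤ B := by
    have : 0 ≤ |q1| + |q2| + |q3| + |q4| + |q5| + |q6| + |q7| + |q8| + |q9| + |q10| + |q11| + |q12| +
      |q13| + |q14| := by positivity
    linarith
  have h15' := mul_le_mul_of_nonneg_right h15 (mul_nonneg hCR hS0)
  rw [abs_le] at e1 e2 e3 e4 e5 e6 e7 e8 e9 e10 e11 e12 e13 e14 e15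
  have hexp : B * (1 + CR) * S = B * S + B * (CR * S) := by ring
  have hq15S : 0 ≤ |q15| * S := mul_nonneg (abs_nonneg _) hS0
  rw [hexp, abs_le]
  constructor
  · linarith [e1.1, e2.1, e3.1, e4.1, e5.1, e6.1, e7.1, e8.1, e9.1, e10.1, e11.1, e12.1, e13.1, e14.1, e15.1]
  · linarith [e1.2, e2.2, e3.2, e4.2, e5.2, e6.2, e7.2, e8.2, e9.2, e10.2, e11.2, e12.2, e13.2, e14.2, e15.2]

section Solution

variable {σ T η₀ : ℝ} {F : ℝ → ℝ} {ρ θ : ℝ → T3 → ℝ} {u : ℝ → T3 → V3}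

/-- **The scaled relative flux is the grouped quadratic form** (see `psi_identity`): at a point
`(τ, x)` of the classical solution and a comparison state `V` (`V₁ > 0`),
`θ²ρ (∂ₜλ·(V - U) + Σᵢ ∂ᵢλ·(fᵢ(V) - fᵢ(U)))` equals the machine-generated grouped polynomial in
the increments `V₁ - ρ`, `V₂/V₁ - u`, `θo(V) - θ` and the Taylor remainder of `Z`. -/
theorem relFlux_scaled_eq (hE : IsHardSphereEulerSolution σ T ρ u θ) (hσ : 0 < σ)
    (hFa : AnalyticOnNhd ℝ F (Ioo (-η₀) η₀)) (hF : EqOn hsExcessFreeEnergy F (Ico 0 η₀))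
    (hpack : ∀ t ∈ Ico 0 T, ∀ x, ρ t x * σ ^ 3 < η₀)
    (θo : (ℝ × V3 × ℝ) → ℝ)
    (hθo : θo = fun U => 2 / 3 * (U.2.2 / U.1 - ‖U.2.1‖ ^ 2 / (2 * U.1 ^ 2)))
    (flux : Fin 3 → (ℝ × V3 × ℝ) → (ℝ × V3 × ℝ))
    (hflux : flux = fun i U => (U.2.1 i, (U.2.1 i / U.1) • U.2.1 +
      hsPressure σ U.1 (θo U) • EuclideanSpace.single i (1 : ℝ),
      (U.2.2 + hsPressure σ U.1 (θo U)) * U.2.1 i / U.1))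
    (pair : (ℝ × V3 × ℝ) → (ℝ × V3 × ℝ) → ℝ)
    (hpair : pair = fun L U => L.1 * U.1 + (∑ j, L.2.1 j * U.2.1 j) + L.2.2 * U.2.2)
    {τ : ℝ} (hτ : τ ∈ Ico 0 T) (x : T3) {V : ℝ × V3 × ℝ} (hV1 : 0 < V.1) :
    θ τ x ^ 2 * ρ τ x * (pair (Torus.timeDerivWithin (Ico 0 T)
      (fun s y => ((-(3 / 2 * Real.log (θ s y) - Real.log (ρ s y) -
        hsExcessFreeEnergy (ρ s y * σ ^ 3)) + 5 / 2 - ‖u s y‖ ^ 2 / (2 * θ s y) +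
        ρ s y * σ ^ 3 * deriv hsExcessFreeEnergy (ρ s y * σ ^ 3) : ℝ),
        (θ s y)⁻¹ • u s y, -(θ s y)⁻¹)) τ x) (V - (ρ τ x, ρ τ x • u τ x, totalEnergyDensity (ρ τ x) (u τ x) (θ τ x))) +
      ∑ i, pair (Torus.partialDeriv i
      (fun y => ((-(3 / 2 * Real.log (θ τ y) - Real.log (ρ τ y) -
        hsExcessFreeEnergy (ρ τ y * σ ^ 3)) + 5 / 2 - ‖u τ y‖ ^ 2 / (2 * θ τ y) +
        ρ τ y * σ ^ 3 * deriv hsExcessFreeEnergy (ρ τ y * σ ^ 3) : ℝ),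
        (θ τ y)⁻¹ • u τ y, -(θ τ y)⁻¹)) x) (flux i V - flux i (ρ τ x, ρ τ x • u τ x, totalEnergyDensity (ρ τ x) (u τ x) (θ τ x)))) =
      (V.1 - ρ τ x) * (V.1 - ρ τ x) * (deriv F (ρ τ x * σ ^ (3 : ℕ)) * Torus.partialDeriv 0 (u τ) x 0 * ρ τ x * σ ^ (3 : ℕ) * θ τ x ^ (2 : ℕ) + deriv F (ρ τ x * σ ^ (3 : ℕ)) * Torus.partialDeriv 1 (u τ) x 1 * ρ τ x * σ ^ (3 : ℕ) * θ τ x ^ (2 : ℕ) + deriv F (ρ τ x * σ ^ (3 : ℕ)) * Torus.partialDeriv 2 (u τ) x 2 * ρ τ x * σ ^ (3 : ℕ) * θ τ x ^ (2 : ℕ) + deriv (deriv F) (ρ τ x * σ ^ (3 : ℕ)) * Torus.partialDeriv 0 (u τ) x 0 * ρ τ x ^ (2 : ℕ) * σ ^ (6 : ℕ) * θ τ x ^ (2 : ℕ) + deriv (deriv F) (ρ τ x * σ ^ (3 : ℕ)) * Torus.partialDeriv 1 (u τ) x 1 * ρ τ x ^ (2 : ℕ) * σ ^ (6 : ℕ)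 * θ τ x ^ (2 : ℕ) + deriv (deriv F) (ρ τ x * σ ^ (3 : ℕ)) * Torus.partialDeriv 2 (u τ) x 2 * ρ τ x ^ (2 : ℕ) * σ ^ (6 : ℕ) * θ τ x ^ (2 : ℕ) + deriv F (ρ τ x * σ ^ (3 : ℕ)) * ((V.1⁻¹ * V.2.1 0) - u τ x 0) * (θo V - θ τ x) * Torus.partialDeriv 0 (θ τ) x * ρ τ x * σ ^ (3 : ℕ) + deriv F (ρ τ x * σ ^ (3 : ℕ)) * ((V.1⁻¹ * V.2.1 0) - u τ x 0) * Torus.partialDeriv 0 (θ τ) x * ρ τ x * σ ^ (3 : ℕ) * θ τ x + deriv F (ρ τ x * σ ^ (3 : ℕ)) * ((V.1⁻¹ * V.2.1 1) - u τ x 1) * (θo V - θ τ x) * Torus.partialDeriv 1 (θ τ) x * ρ τ x * σ ^ (3 : ℕ) + deriv F (ρ τ x * σ ^ (3 : ℕ)) * ((V.1⁻¹ * V.2.1 1) - u τ x 1) * Torus.partialDeriv 1 (θ τ) x * ρ τ x * σ ^ (3 : ℕ) * θ τ x + deriv F (ρ τ x * σ ^ (3 : ℕ)) * ((V.1⁻¹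 * V.2.1 2) - u τ x 2) * (θo V - θ τ x) * Torus.partialDeriv 2 (θ τ) x * ρ τ x * σ ^ (3 : ℕ) + deriv F (ρ τ x * σ ^ (3 : ℕ)) * ((V.1⁻¹ * V.2.1 2) - u τ x 2) * Torus.partialDeriv 2 (θ τ) x * ρ τ x * σ ^ (3 : ℕ) * θ τ x + deriv F (ρ τ x * σ ^ (3 : ℕ)) * (θo V - θ τ x) * Torus.partialDeriv 0 (u τ) x 0 * ρ τ x * σ ^ (3 : ℕ) * θ τ x + deriv F (ρ τ x * σ ^ (3 : ℕ)) * (θo V - θ τ x) * Torus.partialDeriv 1 (u τ) x 1 * ρ τ x * σ ^ (3 : ℕ) * θ τ x + deriv F (ρ τ x * σ ^ (3 : ℕ)) * (θo V - θ τ x) * Torus.partialDeriv 2 (u τ) x 2 * ρ τ x * σ ^ (3 : ℕ) * θ τ x + deriv (deriv F) (ρ τ x * σ ^ (3 : ℕ)) * ((V.1⁻¹ * V.2.1 0) - u τ x 0) * (θo V - θ τ x) * Torus.partialDeriv 0 (θ τ) x * ρ τ x ^ (2 : ℕ) * σ ^ (6 : ℕ) + deriv (deriv F) (ρ τ x * σ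 ^ (3 : ℕ)) * ((V.1⁻¹ * V.2.1 0) - u τ x 0) * Torus.partialDeriv 0 (θ τ) x * ρ τ x ^ (2 : ℕ) * σ ^ (6 : ℕ) * θ τ x + deriv (deriv F) (ρ τ x * σ ^ (3 : ℕ)) * ((V.1⁻¹ * V.2.1 1) - u τ x 1) * (θo V - θ τ x) * Torus.partialDeriv 1 (θ τ) x * ρ τ x ^ (2 : ℕ) * σ ^ (6 : ℕ) + deriv (deriv F) (ρ τ x * σ ^ (3 : ℕ)) * ((V.1⁻¹ * V.2.1 1) - u τ x 1) * Torus.partialDeriv 1 (θ τ) x * ρ τ x ^ (2 : ℕ) * σ ^ (6 : ℕ) * θ τ x + deriv (deriv F) (ρ τ x * σ ^ (3 : ℕ)) * ((V.1⁻¹ * V.2.1 2) - u τ x 2) * (θo V - θ τ x) * Torus.partialDeriv 2 (θ τ) x * ρ τ x ^ (2 : ℕ) * σ ^ (6 : ℕ) + deriv (deriv F) (ρ τ x * σ ^ (3 : ℕ)) * ((V.1⁻¹ * V.2.1 2) - u τ x 2) * Torus.partialDeriv 2 (θ τ) x * ρ τ x ^ (2 : ℕ) * σ ^ (6 : ℕ)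 * θ τ x + deriv (deriv F) (ρ τ x * σ ^ (3 : ℕ)) * (θo V - θ τ x) * Torus.partialDeriv 0 (u τ) x 0 * ρ τ x ^ (2 : ℕ) * σ ^ (6 : ℕ) * θ τ x + deriv (deriv F) (ρ τ x * σ ^ (3 : ℕ)) * (θo V - θ τ x) * Torus.partialDeriv 1 (u τ) x 1 * ρ τ x ^ (2 : ℕ) * σ ^ (6 : ℕ) * θ τ x + deriv (deriv F) (ρ τ x * σ ^ (3 : ℕ)) * (θo V - θ τ x) * Torus.partialDeriv 2 (u τ) x 2 * ρ τ x ^ (2 : ℕ) * σ ^ (6 : ℕ) * θ τ x) +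
      (V.1 - ρ τ x) * ((V.1⁻¹ * V.2.1 0) - u τ x 0) * (1 / 2 * ((V.1⁻¹ * V.2.1 0) - u τ x 0) ^ (2 : ℕ) * Torus.partialDeriv 0 (θ τ) x * ρ τ x + 1 / 2 * ((V.1⁻¹ * V.2.1 1) - u τ x 1) ^ (2 : ℕ) * Torus.partialDeriv 0 (θ τ) x * ρ τ x + 1 / 2 * ((V.1⁻¹ * V.2.1 2) - u τ x 2) ^ (2 : ℕ) * Torus.partialDeriv 0 (θ τ) x * ρ τ x + 5 / 2 * (θo V - θ τ x) * Torus.partialDeriv 0 (θ τ) x * ρ τ x + 1 / 2 * ((V.1⁻¹ * V.2.1 0) - u τ x 0) * ((V.1⁻¹ * V.2.1 1) - u τ x 1) * Torus.partialDeriv 1 (θ τ) x * ρ τ x + 1 / 2 * ((V.1⁻¹ * V.2.1 0) - u τ x 0) * ((V.1⁻¹ * V.2.1 2) - u τ x 2) * Torus.partialDeriv 2 (θ τ) x * ρ τ x + 2 / 3 * ((V.1⁻¹ * V.2.1 0) - u τ x 0) * Torus.partialDeriv 0 (u τ) x 0 * ρ τ x * θ τ x - 1 / 3 * ((V.1⁻¹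 * V.2.1 0) - u τ x 0) * Torus.partialDeriv 1 (u τ) x 1 * ρ τ x * θ τ x - 1 / 3 * ((V.1⁻¹ * V.2.1 0) - u τ x 0) * Torus.partialDeriv 2 (u τ) x 2 * ρ τ x * θ τ x + ((V.1⁻¹ * V.2.1 1) - u τ x 1) * Torus.partialDeriv 1 (u τ) x 0 * ρ τ x * θ τ x + ((V.1⁻¹ * V.2.1 1) - u τ x 1) * Torus.partialDeriv 0 (u τ) x 1 * ρ τ x * θ τ x + ((V.1⁻¹ * V.2.1 2) - u τ x 2) * Torus.partialDeriv 2 (u τ) x 0 * ρ τ x * θ τ x + ((V.1⁻¹ * V.2.1 2) - u τ x 2) * Torus.partialDeriv 0 (u τ) x 2 * ρ τ x * θ τ x + 2 * deriv F (ρ τ x * σ ^ (3 : ℕ)) * (θo V - θ τ x) * Torus.partialDeriv 0 (θ τ) x * ρ τ x ^ (2 : ℕ) * σ ^ (3 : ℕ) + deriv F (ρ τ x * σ ^ (3 : ℕ)) * Torus.partialDeriv 0 (θ τ) x * ρ τ x ^ (2 : ℕ) * σ ^ (3 : ℕ) * θ τ x + deriv (deriv F) (ρ τ x * σ ^ (3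 : ℕ)) * (θo V - θ τ x) * Torus.partialDeriv 0 (θ τ) x * ρ τ x ^ (3 : ℕ) * σ ^ (6 : ℕ) + deriv (deriv F) (ρ τ x * σ ^ (3 : ℕ)) * Torus.partialDeriv 0 (θ τ) x * ρ τ x ^ (3 : ℕ) * σ ^ (6 : ℕ) * θ τ x - 1 / 3 * deriv F (ρ τ x * σ ^ (3 : ℕ)) * ((V.1⁻¹ * V.2.1 0) - u τ x 0) * Torus.partialDeriv 0 (u τ) x 0 * ρ τ x ^ (2 : ℕ) * σ ^ (3 : ℕ) * θ τ x - 1 / 3 * deriv F (ρ τ x * σ ^ (3 : ℕ)) * ((V.1⁻¹ * V.2.1 0) - u τ x 0) * Torus.partialDeriv 1 (u τ) x 1 * ρ τ x ^ (2 : ℕ) * σ ^ (3 : ℕ) * θ τ x - 1 / 3 * deriv F (ρ τ x * σ ^ (3 : ℕ)) * ((V.1⁻¹ * V.2.1 0) - u τ x 0) * Torus.partialDeriv 2 (u τ) x 2 * ρ τ x ^ (2 : ℕ) * σ ^ (3 : ℕ) * θ τ x) +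
      (V.1 - ρ τ x) * ((V.1⁻¹ * V.2.1 1) - u τ x 1) * (1 / 2 * ((V.1⁻¹ * V.2.1 1) - u τ x 1) ^ (2 : ℕ) * Torus.partialDeriv 1 (θ τ) x * ρ τ x + 1 / 2 * ((V.1⁻¹ * V.2.1 2) - u τ x 2) ^ (2 : ℕ) * Torus.partialDeriv 1 (θ τ) x * ρ τ x + 5 / 2 * (θo V - θ τ x) * Torus.partialDeriv 1 (θ τ) x * ρ τ x + 1 / 2 * ((V.1⁻¹ * V.2.1 1) - u τ x 1) * ((V.1⁻¹ * V.2.1 2) - u τ x 2) * Torus.partialDeriv 2 (θ τ) x * ρ τ x - 1 / 3 * ((V.1⁻¹ * V.2.1 1) - u τ x 1) * Torus.partialDeriv 0 (u τ) x 0 * ρ τ x * θ τ x + 2 / 3 * ((V.1⁻¹ * V.2.1 1) - u τ x 1) * Torus.partialDeriv 1 (u τ) x 1 * ρ τ x * θ τ x - 1 / 3 * ((V.1⁻¹ * V.2.1 1) - u τ x 1) * Torus.partialDeriv 2 (u τ) x 2 * ρ τ x * θ τ x + ((V.1⁻¹ * V.2.1 2) - u τ x 2) * Torus.partialDeriv 2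 (u τ) x 1 * ρ τ x * θ τ x + ((V.1⁻¹ * V.2.1 2) - u τ x 2) * Torus.partialDeriv 1 (u τ) x 2 * ρ τ x * θ τ x + 2 * deriv F (ρ τ x * σ ^ (3 : ℕ)) * (θo V - θ τ x) * Torus.partialDeriv 1 (θ τ) x * ρ τ x ^ (2 : ℕ) * σ ^ (3 : ℕ) + deriv F (ρ τ x * σ ^ (3 : ℕ)) * Torus.partialDeriv 1 (θ τ) x * ρ τ x ^ (2 : ℕ) * σ ^ (3 : ℕ) * θ τ x + deriv (deriv F) (ρ τ x * σ ^ (3 : ℕ)) * (θo V - θ τ x) * Torus.partialDeriv 1 (θ τ) x * ρ τ x ^ (3 : ℕ) * σ ^ (6 : ℕ) + deriv (deriv F) (ρ τ x * σ ^ (3 : ℕ)) * Torus.partialDeriv 1 (θ τ) x * ρ τ x ^ (3 : ℕ) * σ ^ (6 : ℕ) * θ τ x - 1 / 3 * deriv F (ρ τ x * σ ^ (3 : ℕ)) * ((V.1⁻¹ * V.2.1 1) - u τ x 1) * Torus.partialDeriv 0 (u τ) x 0 * ρ τ x ^ (2 : ℕ) * σ ^ (3 : ℕ) * θ τ x - 1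 / 3 * deriv F (ρ τ x * σ ^ (3 : ℕ)) * ((V.1⁻¹ * V.2.1 1) - u τ x 1) * Torus.partialDeriv 1 (u τ) x 1 * ρ τ x ^ (2 : ℕ) * σ ^ (3 : ℕ) * θ τ x - 1 / 3 * deriv F (ρ τ x * σ ^ (3 : ℕ)) * ((V.1⁻¹ * V.2.1 1) - u τ x 1) * Torus.partialDeriv 2 (u τ) x 2 * ρ τ x ^ (2 : ℕ) * σ ^ (3 : ℕ) * θ τ x) +
      (V.1 - ρ τ x) * ((V.1⁻¹ * V.2.1 2) - u τ x 2) * (1 / 2 * ((V.1⁻¹ * V.2.1 2) - u τ x 2) ^ (2 : ℕ) * Torus.partialDeriv 2 (θ τ) x * ρ τ x + 5 / 2 * (θo V - θ τ x) * Torus.partialDeriv 2 (θ τ) x * ρ τ x - 1 / 3 * ((V.1⁻¹ * V.2.1 2) - u τ x 2) * Torus.partialDeriv 0 (u τ) x 0 * ρ τ x * θ τ x - 1 / 3 * ((V.1⁻¹ * V.2.1 2) - u τ x 2) * Torus.partialDeriv 1 (u τ) x 1 * ρ τ x * θ τ x + 2 / 3 * ((V.1⁻¹ * V.2.1 2) -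 u τ x 2) * Torus.partialDeriv 2 (u τ) x 2 * ρ τ x * θ τ x + 2 * deriv F (ρ τ x * σ ^ (3 : ℕ)) * (θo V - θ τ x) * Torus.partialDeriv 2 (θ τ) x * ρ τ x ^ (2 : ℕ) * σ ^ (3 : ℕ) + deriv F (ρ τ x * σ ^ (3 : ℕ)) * Torus.partialDeriv 2 (θ τ) x * ρ τ x ^ (2 : ℕ) * σ ^ (3 : ℕ) * θ τ x + deriv (deriv F) (ρ τ x * σ ^ (3 : ℕ)) * (θo V - θ τ x) * Torus.partialDeriv 2 (θ τ) x * ρ τ x ^ (3 : ℕ) * σ ^ (6 : ℕ) + deriv (deriv F) (ρ τ x * σ ^ (3 : ℕ)) * Torus.partialDeriv 2 (θ τ) x * ρ τ x ^ (3 : ℕ) * σ ^ (6 : ℕ) * θ τ x - 1 / 3 * deriv F (ρ τ x * σ ^ (3 : ℕ)) * ((V.1⁻¹ * V.2.1 2) - u τ x 2) * Torus.partialDeriv 0 (u τ) x 0 * ρ τ x ^ (2 : ℕ) * σ ^ (3 : ℕ) * θ τ x - 1 / 3 * deriv F (ρ τ x * σ ^ (3 : ℕ)) * ((V.1⁻¹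 * V.2.1 2) - u τ x 2) * Torus.partialDeriv 1 (u τ) x 1 * ρ τ x ^ (2 : ℕ) * σ ^ (3 : ℕ) * θ τ x - 1 / 3 * deriv F (ρ τ x * σ ^ (3 : ℕ)) * ((V.1⁻¹ * V.2.1 2) - u τ x 2) * Torus.partialDeriv 2 (u τ) x 2 * ρ τ x ^ (2 : ℕ) * σ ^ (3 : ℕ) * θ τ x) +
      (V.1 - ρ τ x) * (θo V - θ τ x) * (deriv F (ρ τ x * σ ^ (3 : ℕ)) * Torus.partialDeriv 0 (u τ) x 0 * ρ τ x ^ (2 : ℕ) * σ ^ (3 : ℕ) * θ τ x + deriv F (ρ τ x * σ ^ (3 : ℕ)) * Torus.partialDeriv 1 (u τ) x 1 * ρ τ x ^ (2 : ℕ) * σ ^ (3 : ℕ) * θ τ x + deriv F (ρ τ x * σ ^ (3 : ℕ)) * Torus.partialDeriv 2 (u τ) x 2 * ρ τ x ^ (2 : ℕ) * σ ^ (3 : ℕ) * θ τ x + deriv (deriv F) (ρ τ x * σ ^ (3 : ℕ)) * Torus.partialDeriv 0 (u τ) x 0 * ρ τ x ^ (3 : ℕ) * σ ^ (6 : ℕ)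 * θ τ x + deriv (deriv F) (ρ τ x * σ ^ (3 : ℕ)) * Torus.partialDeriv 1 (u τ) x 1 * ρ τ x ^ (3 : ℕ) * σ ^ (6 : ℕ) * θ τ x + deriv (deriv F) (ρ τ x * σ ^ (3 : ℕ)) * Torus.partialDeriv 2 (u τ) x 2 * ρ τ x ^ (3 : ℕ) * σ ^ (6 : ℕ) * θ τ x) +
      ((V.1⁻¹ * V.2.1 0) - u τ x 0) * ((V.1⁻¹ * V.2.1 0) - u τ x 0) * (1 / 2 * ((V.1⁻¹ * V.2.1 0) - u τ x 0) * Torus.partialDeriv 0 (θ τ) x * ρ τ x ^ (2 : ℕ) + 1 / 2 * ((V.1⁻¹ * V.2.1 1) - u τ x 1) * Torus.partialDeriv 1 (θ τ) x * ρ τ x ^ (2 : ℕ) + 1 / 2 * ((V.1⁻¹ * V.2.1 2) - u τ x 2) * Torus.partialDeriv 2 (θ τ) x * ρ τ x ^ (2 : ℕ) + 2 / 3 * Torus.partialDeriv 0 (u τ) x 0 * ρ τ x ^ (2 : ℕ) * θ τ x - 1 / 3 * Torus.partialDeriv 1 (u τ) x 1 * ρ τ x ^ (2 : ℕ) * θ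 τ x - 1 / 3 * Torus.partialDeriv 2 (u τ) x 2 * ρ τ x ^ (2 : ℕ) * θ τ x - 1 / 3 * deriv F (ρ τ x * σ ^ (3 : ℕ)) * Torus.partialDeriv 0 (u τ) x 0 * ρ τ x ^ (3 : ℕ) * σ ^ (3 : ℕ) * θ τ x - 1 / 3 * deriv F (ρ τ x * σ ^ (3 : ℕ)) * Torus.partialDeriv 1 (u τ) x 1 * ρ τ x ^ (3 : ℕ) * σ ^ (3 : ℕ) * θ τ x - 1 / 3 * deriv F (ρ τ x * σ ^ (3 : ℕ)) * Torus.partialDeriv 2 (u τ) x 2 * ρ τ x ^ (3 : ℕ) * σ ^ (3 : ℕ) * θ τ x) +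
      ((V.1⁻¹ * V.2.1 0) - u τ x 0) * ((V.1⁻¹ * V.2.1 1) - u τ x 1) * (1 / 2 * ((V.1⁻¹ * V.2.1 1) - u τ x 1) * Torus.partialDeriv 0 (θ τ) x * ρ τ x ^ (2 : ℕ) + Torus.partialDeriv 1 (u τ) x 0 * ρ τ x ^ (2 : ℕ) * θ τ x + Torus.partialDeriv 0 (u τ) x 1 * ρ τ x ^ (2 : ℕ) * θ τ x) +
      ((V.1⁻¹ * V.2.1 0) - u τ x 0) * ((V.1⁻¹ * V.2.1 2) - u τ x 2) * (1 / 2 * ((V.1⁻¹ * V.2.1 2) - u τ x 2) * Torus.partialDeriv 0 (θ τ) x * ρ τ x ^ (2 : ℕ) + Torus.partialDeriv 2 (u τ) x 0 * ρ τ x ^ (2 : ℕ) * θ τ x + Torus.partialDeriv 0 (u τ) x 2 * ρ τ x ^ (2 : ℕ) * θ τ x) +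
      ((V.1⁻¹ * V.2.1 0) - u τ x 0) * (θo V - θ τ x) * (5 / 2 * Torus.partialDeriv 0 (θ τ) x * ρ τ x ^ (2 : ℕ) + deriv F (ρ τ x * σ ^ (3 : ℕ)) * Torus.partialDeriv 0 (θ τ) x * ρ τ x ^ (3 : ℕ) * σ ^ (3 : ℕ)) +
      ((V.1⁻¹ * V.2.1 1) - u τ x 1) * ((V.1⁻¹ * V.2.1 1) - u τ x 1) * (1 / 2 * ((V.1⁻¹ * V.2.1 1) - u τ x 1) * Torus.partialDeriv 1 (θ τ) x * ρ τ x ^ (2 : ℕ) + 1 / 2 * ((V.1⁻¹ * V.2.1 2) - u τ x 2) * Torus.partialDeriv 2 (θ τ) x * ρ τ x ^ (2 : ℕ) - 1 / 3 * Torus.partialDeriv 0 (u τ) x 0 * ρ τ x ^ (2 : ℕ) * θ τ x + 2 / 3 * Torus.partialDeriv 1 (u τ) x 1 * ρ τ x ^ (2 : ℕ) * θ τ x - 1 / 3 * Torus.partialDeriv 2 (u τ) x 2 * ρ τ x ^ (2 : ℕ) * θ τ x - 1 / 3 * deriv F (ρ τ x * σ ^ (3 : ℕ)) * Torus.partialDeriv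 0 (u τ) x 0 * ρ τ x ^ (3 : ℕ) * σ ^ (3 : ℕ) * θ τ x - 1 / 3 * deriv F (ρ τ x * σ ^ (3 : ℕ)) * Torus.partialDeriv 1 (u τ) x 1 * ρ τ x ^ (3 : ℕ) * σ ^ (3 : ℕ) * θ τ x - 1 / 3 * deriv F (ρ τ x * σ ^ (3 : ℕ)) * Torus.partialDeriv 2 (u τ) x 2 * ρ τ x ^ (3 : ℕ) * σ ^ (3 : ℕ) * θ τ x) +
      ((V.1⁻¹ * V.2.1 1) - u τ x 1) * ((V.1⁻¹ * V.2.1 2) - u τ x 2) * (1 / 2 * ((V.1⁻¹ * V.2.1 2) - u τ x 2) * Torus.partialDeriv 1 (θ τ) x * ρ τ x ^ (2 : ℕ) + Torus.partialDeriv 2 (u τ) x 1 * ρ τ x ^ (2 : ℕ) * θ τ x + Torus.partialDeriv 1 (u τ) x 2 * ρ τ x ^ (2 : ℕ) * θ τ x) +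
      ((V.1⁻¹ * V.2.1 1) - u τ x 1) * (θo V - θ τ x) * (5 / 2 * Torus.partialDeriv 1 (θ τ) x * ρ τ x ^ (2 : ℕ) + deriv F (ρ τ x * σ ^ (3 : ℕ)) * Torus.partialDeriv 1 (θ τ) x * ρ τ x ^ (3 : ℕ) * σ ^ (3 : ℕ)) +
      ((V.1⁻¹ * V.2.1 2) - u τ x 2) * ((V.1⁻¹ * V.2.1 2) - u τ x 2) * (1 / 2 * ((V.1⁻¹ * V.2.1 2) - u τ x 2) * Torus.partialDeriv 2 (θ τ) x * ρ τ x ^ (2 : ℕ) - 1 / 3 * Torus.partialDeriv 0 (u τ) x 0 * ρ τ x ^ (2 : ℕ) * θ τ x - 1 / 3 * Torus.partialDeriv 1 (u τ) x 1 * ρ τ x ^ (2 : ℕ) * θ τ x + 2 / 3 * Torus.partialDeriv 2 (u τ) x 2 * ρ τ x ^ (2 : ℕ) * θ τ x - 1 / 3 * deriv F (ρ τ x * σ ^ (3 : ℕ)) * Torus.partialDeriv 0 (u τ) x 0 * ρ τ x ^ (3 : ℕ) * σ ^ (3 : ℕ) * θ τ x - 1 / 3 * deriv F (ρ τ x * σ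 ^ (3 : ℕ)) * Torus.partialDeriv 1 (u τ) x 1 * ρ τ x ^ (3 : ℕ) * σ ^ (3 : ℕ) * θ τ x - 1 / 3 * deriv F (ρ τ x * σ ^ (3 : ℕ)) * Torus.partialDeriv 2 (u τ) x 2 * ρ τ x ^ (3 : ℕ) * σ ^ (3 : ℕ) * θ τ x) +
      ((V.1⁻¹ * V.2.1 2) - u τ x 2) * (θo V - θ τ x) * (5 / 2 * Torus.partialDeriv 2 (θ τ) x * ρ τ x ^ (2 : ℕ) + deriv F (ρ τ x * σ ^ (3 : ℕ)) * Torus.partialDeriv 2 (θ τ) x * ρ τ x ^ (3 : ℕ) * σ ^ (3 : ℕ)) +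
      (hsCompressibility (V.1 * σ ^ (3 : ℕ)) - (1 + ρ τ x * σ ^ (3 : ℕ) * deriv F (ρ τ x * σ ^ (3 : ℕ))) - (σ ^ (3 : ℕ) * deriv F (ρ τ x * σ ^ (3 : ℕ)) + ρ τ x * σ ^ (6 : ℕ) * deriv (deriv F) (ρ τ x * σ ^ (3 : ℕ))) * (V.1 - ρ τ x)) * (Torus.partialDeriv 0 (u τ) x 0 * ρ τ x ^ (2 : ℕ) * θ τ x ^ (2 : ℕ) + Torus.partialDeriv 1 (u τ) x 1 * ρ τ x ^ (2 : ℕ) * θ τ x ^ (2 : ℕ) + Torus.partialDeriv 2 (u τ) x 2 * ρ τ x ^ (2 : ℕ) * θ τ x ^ (2 : ℕ) + (V.1 - ρ τ x) * Torus.partialDeriv 0 (u τ) x 0 * ρ τ x * θ τ x ^ (2 : ℕ) + (V.1 - ρ τ x) * Torus.partialDeriv 1 (u τ) x 1 * ρ τ x * θ τ x ^ (2 : ℕ) + (V.1 - ρ τ x) * Torus.partialDeriv 2 (u τ) x 2 * ρ τ x * θ τ x ^ (2 : ℕ) + ((V.1⁻¹ * V.2.1 0) - u τ x 0) * (θo V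 - θ τ x) * Torus.partialDeriv 0 (θ τ) x * ρ τ x ^ (2 : ℕ) + ((V.1⁻¹ * V.2.1 0) - u τ x 0) * Torus.partialDeriv 0 (θ τ) x * ρ τ x ^ (2 : ℕ) * θ τ x + ((V.1⁻¹ * V.2.1 1) - u τ x 1) * (θo V - θ τ x) * Torus.partialDeriv 1 (θ τ) x * ρ τ x ^ (2 : ℕ) + ((V.1⁻¹ * V.2.1 1) - u τ x 1) * Torus.partialDeriv 1 (θ τ) x * ρ τ x ^ (2 : ℕ) * θ τ x + ((V.1⁻¹ * V.2.1 2) - u τ x 2) * (θo V - θ τ x) * Torus.partialDeriv 2 (θ τ) x * ρ τ x ^ (2 : ℕ) + ((V.1⁻¹ * V.2.1 2) - u τ x 2) * Torus.partialDeriv 2 (θ τ) x * ρ τ x ^ (2 : ℕ) * θ τ x + (θo V - θ τ x) * Torus.partialDeriv 0 (u τ) x 0 * ρ τ x ^ (2 : ℕ) * θ τ x + (θo V - θ τ x) * Torus.partialDeriv 1 (u τ) x 1 * ρ τ x ^ (2 : ℕ) * θ τ x + (θo V - θ τ x) * Torus.partialDeriv 2 (u τ) x 2 * ρ τ x ^ (2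 : ℕ) * θ τ x + (V.1 - ρ τ x) * ((V.1⁻¹ * V.2.1 0) - u τ x 0) * (θo V - θ τ x) * Torus.partialDeriv 0 (θ τ) x * ρ τ x + (V.1 - ρ τ x) * ((V.1⁻¹ * V.2.1 0) - u τ x 0) * Torus.partialDeriv 0 (θ τ) x * ρ τ x * θ τ x + (V.1 - ρ τ x) * ((V.1⁻¹ * V.2.1 1) - u τ x 1) * (θo V - θ τ x) * Torus.partialDeriv 1 (θ τ) x * ρ τ x + (V.1 - ρ τ x) * ((V.1⁻¹ * V.2.1 1) - u τ x 1) * Torus.partialDeriv 1 (θ τ) x * ρ τ x * θ τ x + (V.1 - ρ τ x) * ((V.1⁻¹ * V.2.1 2) - u τ x 2) * (θo V - θ τ x) * Torus.partialDeriv 2 (θ τ) x * ρ τ x + (V.1 - ρ τ x) * ((V.1⁻¹ * V.2.1 2) - u τ x 2) * Torus.partialDeriv 2 (θ τ) x * ρ τ x * θ τ x + (V.1 - ρ τ x) * (θo V - θ τ x) * Torus.partialDeriv 0 (u τ) x 0 * ρ τ x * θ τ x + (V.1 - ρ τ x) * (θo V - θ τ x) * Torus.partialDeriv 1 (u τ)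 x 1 * ρ τ x * θ τ x + (V.1 - ρ τ x) * (θo V - θ τ x) * Torus.partialDeriv 2 (u τ) x 2 * ρ τ x * θ τ x) := by
  rw [Fin.sum_univ_three, mul_add, mul_add, mul_add,
    time_piece_eq hE hσ hFa hF hpack θo hθo pair hpair hτ x hV1,
    space_piece_eq_0 hE hσ hFa hF hpack θo hθo flux hflux pair hpair hτ x hV1,
    space_piece_eq_1 hE hσ hFa hF hpack θo hθo flux hflux pair hpair hτ x hV1,
    space_piece_eq_2 hE hσ hFa hF hpack θo hθo flux hflux pair hpair hτ x hV1]
  have key := psi_identity (ρ τ x) (θ τ x) (u τ x 0) (u τ x 1) (u τ x 2) (Torus.partialDeriv 0 (ρ τ) x) (Torus.partialDeriv 1 (ρ τ) x) (Torus.partialDeriv 2 (ρ τ) x) (Torus.partialDeriv 0 (θ τ) x) (Torus.partialDeriv 1 (θ τ) x) (Torus.partialDeriv 2 (θ τ) x) (Torus.partialDeriv 0 (u τ) x 0) (Torus.partialDeriv 1 (u τ) x 0) (Torus.partialDeriv 2 (u τ) x 0) (Torus.partialDeriv 0 (u τ) x 1) (Torus.partialDeriv 1 (u τ) x 1) (Torus.partialDeriv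 2 (u τ) x 1) (Torus.partialDeriv 0 (u τ) x 2) (Torus.partialDeriv 1 (u τ) x 2) (Torus.partialDeriv 2 (u τ) x 2) (σ) (deriv F (ρ τ x * σ ^ 3)) (deriv (deriv F) (ρ τ x * σ ^ 3)) (V.1) (θo V) ((V.1⁻¹ * V.2.1 0)) ((V.1⁻¹ * V.2.1 1)) ((V.1⁻¹ * V.2.1 2)) (hsCompressibility (V.1 * σ ^ 3))
  linear_combination key

/-- **A compact interval of densities.** The densities of the classical solution on
`[0, t] × 𝕋³` (`t < T`) and the first components of the states in the compact set `K` (inside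
the low-packing region) all lie in one interval `[y₁, y₂]` with `0 < y₁` and `y₂σ³ < η₀`. -/
theorem exists_packing_interval (hE : IsHardSphereEulerSolution σ T ρ u θ)
    (hpack : ∀ t ∈ Ico 0 T, ∀ x, ρ t x * σ ^ 3 < η₀) {t : ℝ} (ht : t ∈ Ico 0 T)
    {K : Set (ℝ × V3 × ℝ)} (hK : IsCompact K)
    (hKΩ : K ⊆ {U : ℝ × V3 × ℝ | 0 < U.1 ∧ U.1 * σ ^ 3 < η₀ ∧ ‖U.2.1‖ ^ 2 < 2 * U.1 * U.2.2}) :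
    ∃ y₁ y₂ : ℝ, 0 < y₁ ∧ y₂ * σ ^ 3 < η₀ ∧ (∀ τ ∈ Icc 0 t, ∀ x, ρ τ x ∈ Icc y₁ y₂) ∧
      ∀ V ∈ K, V.1 ∈ Icc y₁ y₂ := by
  have htT : Icc 0 t ⊆ Ico 0 T := Icc_subset_Ico_right ht.2
  obtain ⟨ρmin, hρmin0, hρmin⟩ := HsEulerCalc.exists_pos_le_of_isSmoothSpaceTimeOn hE.smooth_density
    hE.density_pos ht.2
  obtain ⟨rmin, hrmin0, hrmin⟩ := exists_pos_lower_bound hK continuousOn_fst fun V hV => (hKΩ hV).1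
  -- the maximum of the density on the compact slab is attained
  have hcont : ContinuousOn (uncurry ρ) (Icc 0 t ×ˢ univ) :=
    hE.smooth_density.continuousOn_uncurry.mono (prod_mono htT subset_rfl)
  have hne : (Icc (0:ℝ) t ×ˢ (univ : Set T3)).Nonempty := ⟨(0, 0), ⟨⟨le_rfl, ht.1⟩, mem_univ _⟩⟩
  obtain ⟨p₀, hp₀, hmax⟩ := (isCompact_Icc.prod isCompact_univ).exists_isMaxOn hne hcont
  have hp₀T : p₀.1 ∈ Ico 0 T := htT (mem_prod.1 hp₀).1
  set yρ := ρ p₀.1 p₀.2 with hyρ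
  have hyρ_pack : yρ * σ ^ 3 < η₀ := hpack p₀.1 hp₀T p₀.2
  have hyρ_max : ∀ τ ∈ Icc 0 t, ∀ x, ρ τ x ≤ yρ := fun τ hτ x =>
    hmax (show ((τ, x) : ℝ × T3) ∈ Icc 0 t ×ˢ univ from ⟨hτ, mem_univ x⟩)
  by_cases hKne : K.Nonempty
  · obtain ⟨V₀, hV₀, hVmax⟩ := hK.exists_isMaxOn hKne continuousOn_fst
    refine ⟨min ρmin rmin, max yρ V₀.1, lt_min hρmin0 hrmin0, ?_, ?_, ?_⟩
    · rcases le_total yρ V₀.1 with h | h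
      · rw [max_eq_right h]; exact (hKΩ hV₀).2.1
      · rw [max_eq_left h]; exact hyρ_pack
    · intro τ hτ x
      exact ⟨(min_le_left _ _).trans (hρmin τ hτ x), (hyρ_max τ hτ x).trans (le_max_left _ _)⟩
    · intro V hV
      exact ⟨(min_le_right _ _).trans (hrmin V hV), le_trans (hVmax hV) (le_max_right _ _)⟩
  · refine ⟨ρmin, yρ, hρmin0, hyρ_pack, fun τ hτ x => ⟨hρmin τ hτ x, hyρ_max τ hτ x⟩, ?_⟩
    intro V hV; exact (hKne ⟨V, hV⟩).elim

/-- **Uniform Taylor bound for the compressibility factor**: on `[0, t] × 𝕋³ × K`,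
`|Z(V₁σ³) - (1 + ρσ³F'(ρσ³)) - (σ³F'(ρσ³) + ρσ⁶F''(ρσ³))(V₁ - ρ)| ≤ C_R (V₁ - ρ)²`. -/
theorem remainder_bound (hE : IsHardSphereEulerSolution σ T ρ u θ) (hσ : 0 < σ)
    (hFa : AnalyticOnNhd ℝ F (Ioo (-η₀) η₀)) (hF : EqOn hsExcessFreeEnergy F (Ico 0 η₀))
    (hpack : ∀ t ∈ Ico 0 T, ∀ x, ρ t x * σ ^ 3 < η₀) {t : ℝ} (ht : t ∈ Ico 0 T)
    {K : Set (ℝ × V3 × ℝ)} (hK : IsCompact K)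
    (hKΩ : K ⊆ {U : ℝ × V3 × ℝ | 0 < U.1 ∧ U.1 * σ ^ 3 < η₀ ∧ ‖U.2.1‖ ^ 2 < 2 * U.1 * U.2.2}) :
    ∃ CR, 0 ≤ CR ∧ ∀ τ ∈ Icc 0 t, ∀ x, ∀ V ∈ K,
      |hsCompressibility (V.1 * σ ^ 3) - (1 + ρ τ x * σ ^ 3 * deriv F (ρ τ x * σ ^ 3)) -
        (σ ^ 3 * deriv F (ρ τ x * σ ^ 3) + ρ τ x * σ ^ 6 * deriv (deriv F) (ρ τ x * σ ^ 3)) *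
          (V.1 - ρ τ x)| ≤ CR * (V.1 - ρ τ x) ^ 2 := by
  obtain ⟨y₁, y₂, hy₁, hy₂, hρI, hVI⟩ := exists_packing_interval hE hpack ht hK hKΩ
  have hσ3 : 0 < σ ^ 3 := pow_pos hσ 3
  have hsub : Icc y₁ y₂ ⊆ {y : ℝ | y * σ ^ 3 ∈ Ioo (-η₀) η₀} := by
    intro y hy
    have h1 : 0 < y * σ ^ 3 := mul_pos (hy₁.trans_le hy.1) hσ3
    have h2 : y * σ ^ 3 ≤ y₂ * σ ^ 3 := mul_le_mul_of_nonneg_right hy.2 hσ3.le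
    exact ⟨by linarith, h2.trans_lt hy₂⟩
  have hζ2 : ContDiffOn ℝ 2 (fun y => 1 + y * σ ^ 3 * deriv F (y * σ ^ 3))
      {y : ℝ | y * σ ^ 3 ∈ Ioo (-η₀) η₀} := (contDiffOn_zetaF hFa).of_le (by norm_cast)
  obtain ⟨C, hC0, hC⟩ := exists_taylor_two_bound isOpen_packingPreimage hζ2 hsub
  refine ⟨C, hC0, fun τ hτ x V hV => ?_⟩
  have hρmem := hρI τ hτ x
  have hVmem := hVI V hV
  have hVpack : V.1 * σ ^ 3 ∈ Ioo 0 η₀ :=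
    ⟨mul_pos (hy₁.trans_le hVmem.1) hσ3, (hsub hVmem).2⟩
  have h := hC (ρ τ x) hρmem V.1 hVmem
  rw [(hasDerivAt_zetaF hFa (hsub hρmem)).deriv] at h
  rw [hsCompressibility_eq hF hVpack]
  exact h

end Solution

end Summit.AtomisticToContinuum.HydrodynamicLimit.Theorems.EntropicWeakStrong

end
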